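import Literature.AlgebraicGeometry.ComplexMultiplication.OneTypeEigensystemCMHodgeMorphism
import HarnessLib

/-!
# One-type eigensystems of an abstract weight-one Hodge structure — the `∀ χ` form of the hypothesis

Family `hodge`, layer `Literature/AlgebraicGeometry/ComplexMultiplication`; THEOREMS ONLY (no definition, no named
fact — D-0026).  Sequel of `OneTypeEigensystemCMHodgeMorphism` (same sources): there the one-type hypothesis is
stated per CONJUGATE eigensystem `τ ∘ t` (`τ : E(t) → ℂ` an embedding of the eigenvalue field); route R-A's lemma A3
(`pub-hodgecm2-s2crux-idea-2`, `A3-KernelLemma.lean`) states it for ALL eigensystems `χ : T → ℂ` of the commutative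
algebra (`hpure : ∀ χ, eig χ ≤ H^{1,0} ∨ eig χ ≤ H^{0,1}`).  This file converts the latter format (restricted to the
`χ` vanishing on `ker t`, which is weaker) into the former — the abstract twin of the tree's
`PureEigenblockOfCommutingEndomorphisms.oneType_embedding_of_oneType_algHom` — and restates the A3-shaped conclusion
`exists_algHom_cmType_hom_of_oneType` under it.

* `oneType_embedding_of_oneType_algHom_piece` — `∀ χ`-form ⟹ per-embedding form (`τ ∘ t` IS an eigensystem of `R`
  vanishing on `ker t`).
* `exists_algHom_cmType_hom_of_oneType_algHom` — A3 with its own hypothesis format: `ρ : R ↠ E(t)`, `t = σ₀ ∘ ρ`,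
  `σ₀ ∈ Φ`, `Φ` a CM type, a non-zero injective `R`-equivariant `Motives.HodgeStructure.Hom (ofCMType Φ) H` with
  `V^{1,0} ↦ V^{1,0}`, `V^{0,1} ↦ V^{0,1}`.

Relies on: nothing unproved (axioms `propext`, `Classical.choice`, `Quot.sound`).

## References

* [Shimura1998] G. Shimura, *Abelian Varieties with Complex Multiplication and Modular Functions* (1998), §24.1,
  §24.15 Theorem.
* [Deligne1982HodgeCycles] P. Deligne, *Hodge cycles on abelian varieties*, LNM 900 (1982), Example 3.7, §4, §5.
* [GreenGriffithsKerr2012] M. Green, P. A. Griffiths, M. Kerr, *Mumford–Tate Groups and Domains* (2012), §V.B–V.C.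

## Provenance

Cell `pub-hodgecm2` (COR-CM), count-neutral own lane ONETYPE-EIGEN-CMHOM of seat `pub-hodgecm2-b26` (gen 23), part 2.
-/

noncomputable section

open scoped TensorProduct
open Module

namespace Literature.AlgebraicGeometry.ComplexMultiplication

open Literature.AlgebraicGeometry.Motives (CMType)
open Literature.AlgebraicGeometry.Motives.HodgeStructure (ofCMType)

/-! ## §6 The one-type hypothesis in the `∀ χ` form (all eigensystems of `R` vanishing on `ker t`) -/

section AlgHomForm

variable {R : Type*} [CommRing R] [Algebra ℚ R] {V : Type*} [AddCommGroup V] [Module ℚ V]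
  (H : Motives.HodgeStructure V 1) (act : R →ₐ[ℚ] Module.End ℚ V) (t : R →ₐ[ℚ] ℂ)

/-- **From the `∀ χ` form of the one-type hypothesis to the embedding form** (abstract twin of the tree's
`oneType_embedding_of_oneType_algHom`): if every eigensystem `t' : R →ₐ[ℚ] ℂ` vanishing on `ker t` has its joint
eigenvectors all in `V^{1,0}` or all in `V^{0,1}`, then so does every conjugate eigensystem `τ ∘ t`, `τ : E(t) → ℂ`
(which is such a `t'`).  This is the hypothesis format of route R-A's lemma A3 (`hpure : ∀ χ, eig χ ≤ H^{1,0} ∨ eig χ ≤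
H^{0,1}`, there even for ALL `χ`). [cite: Deligne1982HodgeCycles, §4 (p. 30)] -/
theorem oneType_embedding_of_oneType_algHom_piece
    (hall' : ∀ t' : R →ₐ[ℚ] ℂ, (∀ a, t a = 0 → t' a = 0) →
      (∀ x : ℂ ⊗[ℚ] V, (∀ a, (act a).baseChange ℂ x = t' a • x) → x ∈ H.piece 1 0) ∨
      (∀ x : ℂ ⊗[ℚ] V, (∀ a, (act a).baseChange ℂ x = t' a • x) → x ∈ H.piece 0 1))
    (τ : eigenfield t →+* ℂ) :
    (∀ x : ℂ ⊗[ℚ] V, (∀ a, (act a).baseChange ℂ x = τ ⟨t a, apply_mem_eigenfield t a⟩ • x) → x ∈ H.piece 1 0) ∨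
      (∀ x : ℂ ⊗[ℚ] V, (∀ a, (act a).baseChange ℂ x = τ ⟨t a, apply_mem_eigenfield t a⟩ • x) →
        x ∈ H.piece 0 1) := by
  -- the conjugate eigensystem `τ ∘ t` as a `ℚ`-algebra map
  let t' : R →ₐ[ℚ] ℂ :=
    { toFun := fun a ↦ τ ⟨t a, apply_mem_eigenfield t a⟩
      map_one' := by
        rw [show (⟨t 1, apply_mem_eigenfield t 1⟩ : eigenfield t) = 1 from Subtype.ext (map_one t), map_one]
      map_mul' := fun a b ↦ by
        rw [← map_mul]
        exact congrArg τ (Subtype.ext (map_mul t a b))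
      map_zero' := by
        rw [show (⟨t 0, apply_mem_eigenfield t 0⟩ : eigenfield t) = 0 from Subtype.ext (map_zero t), map_zero]
      map_add' := fun a b ↦ by
        rw [← map_add]
        exact congrArg τ (Subtype.ext (map_add t a b))
      commutes' := fun q ↦ by
        rw [show (⟨t (algebraMap ℚ R q), apply_mem_eigenfield t _⟩ : eigenfield t) = algebraMap ℚ (eigenfield t) q
          from Subtype.ext (t.commutes q)]
        simp }
  have ht' : ∀ a, t' a = τ ⟨t a, apply_mem_eigenfield t a⟩ := fun _ ↦ rfl
  have hker : ∀ a, t a = 0 → t' a = 0 := fun a ha ↦ by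
    rw [ht', show (⟨t a, apply_mem_eigenfield t a⟩ : eigenfield t) = 0 from Subtype.ext ha, map_zero]
  exact hall' t' hker

variable [FiniteDimensional ℚ V] [NumberField (eigenfield t)]

/-- **Route R-A's lemma A3 with its own hypothesis format** (`hpure` for every eigensystem of `R` vanishing on
`ker t`; in A3 even for every `χ : T → ℂ`): the conclusion of `exists_algHom_cmType_hom_of_oneType`.
[cite: Shimura1998, §24.15 Theorem] [cite: GreenGriffithsKerr2012, §V.B–V.C] -/
theorem exists_algHom_cmType_hom_of_oneType_algHom
    (hocc : ∃ x : ℂ ⊗[ℚ] V, x ≠ 0 ∧ ∀ a, (act a).baseChange ℂ x = t a • x)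
    (hall' : ∀ t' : R →ₐ[ℚ] ℂ, (∀ a, t a = 0 → t' a = 0) →
      (∀ x : ℂ ⊗[ℚ] V, (∀ a, (act a).baseChange ℂ x = t' a • x) → x ∈ H.piece 1 0) ∨
      (∀ x : ℂ ⊗[ℚ] V, (∀ a, (act a).baseChange ℂ x = t' a • x) → x ∈ H.piece 0 1))
    (h10 : ∀ x : ℂ ⊗[ℚ] V, (∀ a, (act a).baseChange ℂ x = t a • x) → x ∈ H.piece 1 0) :
    ∃ (ρ : R →ₐ[ℚ] eigenfield t) (Φ : CMType (eigenfield t)) (f : Motives.HodgeStructure.Hom (ofCMType Φ) H),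
      Function.Surjective ρ ∧ (∀ a, (ρ a : ℂ) = t a) ∧
      (algebraMap (eigenfield t) ℂ : eigenfield t →+* ℂ) ∈ Φ.1 ∧
      (∀ τ : eigenfield t →+* ℂ, τ ∈ Φ.1 ↔ NumberField.ComplexEmbedding.conjugate τ ∉ Φ.1) ∧
      f.toLinearMap ≠ 0 ∧ Function.Injective f.toLinearMap ∧
      (∀ a : R, act a ∘ₗ f.toLinearMap =
        f.toLinearMap ∘ₗ (Algebra.lmul ℚ (eigenfield t) (ρ a) : Module.End ℚ (eigenfield t))) ∧
      ((ofCMType Φ).piece 1 0).map (f.toLinearMap.baseChange ℂ) ≤ H.piece 1 0 ∧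
      ((ofCMType Φ).piece 0 1).map (f.toLinearMap.baseChange ℂ) ≤ H.piece 0 1 :=
  exists_algHom_cmType_hom_of_oneType H act t hocc
    (fun τ ↦ oneType_embedding_of_oneType_algHom_piece H act t hall' τ) h10

end AlgHomForm

end Literature.AlgebraicGeometry.ComplexMultiplication

end
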